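import Literature.AlgebraicGeometry.HodgeTheory.AlgebraicClassesPullbackHolds
import Literature.AlgebraicGeometry.HodgeTheory.HypersurfaceSectionHodgeConjecture
import Literature.AlgebraicGeometry.HodgeTheory.CoveringHodgeConjecture
import Literature.AlgebraicGeometry.HodgeTheory.UniversalSectionLefschetzPackage
import HarnessLib

/-!
# Hypothesis-free forms of the Lefschetz-section and covering closure rules for the Hodge conjecture
# (the consumers of Fulton's Cor. 19.2 (b), now that the pull-back fact is a Literature theorem)

Topic `Literature/AlgebraicGeometry/HodgeTheory`. THEOREMS ONLY (no definition, no named fact).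

The files `HypersurfaceSectionHodgeConjecture` (cell `hodge-nonav`, chapter LEF: the Hodge conjecture
for hypersurface sections of an arbitrary smooth projective variety — Voisin II Thm. 1.23, Voisin
*Hodge loci* §4.3 Thm. 4.17 / Rem. 4.18) and `CoveringHodgeConjecture` (chapter COV: invariance of the
Hodge conjecture under finite coverings in the Barth–Lefschetz range — Lazarsfeld 1980 Thm. 1,
*Positivity* II Thm. 7.1.15–7.1.16, Debarre 2006 Thm. 1) carry Fulton's Cor. 19.2 (b)
`fulton1998_map_mem_algebraicClasses` (pull-back of algebraic classes along morphisms of smooth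
projective varieties) as the explicit hypothesis `hFul`, "discharged on the summit side". That fact is
now the Literature theorem `fulton1998_map_mem_algebraicClasses_holds'` (`AlgebraicClassesPullbackHolds`,
deformation to the normal cone), so every such theorem has a hypothesis-free form: this file states
them, primed (`foo'` := `foo fulton1998_map_mem_algebraicClasses_holds' …`), statements otherwise
VERBATIM (the remaining named-fact hypotheses `hLaz : Lazarsfeld1980_barthLefschetzForCoverings`,
`hDeb : Debarre2006_coverSimpleAbelian_barthLefschetz` of the covering rungs are kept as printed).

Headline unconditional statements obtained: HC for every smooth ODD-dimensional hypersurface section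
`X ∩ V₊(F)` of a smooth projective `X` with HC(`X`) (`HypersurfaceSectionHC.hodgeConjectureFor_hypersurfaceSection_of_odd_of_hodgeConjectureFor'`);
two-step sections; even-dimensional sections under Voisin's condition (VG); the very general hyperplane
section of an odd-dimensional `X ⊂ ℙᴺ` with HC(`X`) and (VG), Lefschetz package included
(`veryGeneralSection_hodgeConjectureFor''`, from `UniversalSectionLefschetzPackage`); HCᵖ(cover) ⟺ HCᵖ(base)
wherever `g^*` is bijective (`CoveringHC.hodgeClasses_algebraic_iff_of_bijective'`); the covering
window core and its rows (covers of `ℙ^{2k+1}`, fivefold covers, covers of odd hypersurfaces, simple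
abelian windows).

## References

* [Fulton1998] W. Fulton, Intersection Theory, 2nd ed. (1998), §19.2 Cor. 19.2 (b).
* [VoisinHodgeII2003] C. Voisin, Hodge Theory and Complex Algebraic Geometry II (2003), §1.2.2 Thm. 1.23.
* [Voisin2013HodgeLociSurvey] C. Voisin, Hodge loci, §4.3.
* [Lazarsfeld2004PositivityII] R. Lazarsfeld, Positivity in Algebraic Geometry II, Thm. 7.1.15, 7.1.16.
* [Debarre2006] O. Debarre, On coverings of simple abelian varieties, Thm. 1.
-/

noncomputable section

open CategoryTheory AlgebraicGeometry Filter
open Literature.AlgebraicGeometry.Motives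
open Literature.AlgebraicGeometry.HodgeTheory
open Literature.AlgebraicGeometry.HodgeTheory.HypersurfaceSectionHC
open Literature.AlgebraicTopology.SingularHomology

namespace Literature.AlgebraicGeometry.HodgeTheory.HypersurfaceSectionHC

/-! ### Hypersurface sections (chapter LEF) -/

/-- (Hypothesis-free form of `mem_algebraicClasses_of_mem_range`: the pull-back fact `fulton1998_map_mem_algebraicClasses` is
now the Literature theorem `fulton1998_map_mem_algebraicClasses_holds'`.) **Algebraicity descends along an injective pull-back** (modulo Fulton Cor. 19.2 (b), `hFul`):
with `g`, `c` as in §A, if every rational `(p,p)` class on `X` is algebraic then `c` is algebraic. [cite: VoisinHodgeI2002, §7.3.1–7.3.2] [cite: Voisin2013HodgeLociSurvey, §4.3 (pp. 18–19)] -/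
theorem mem_algebraicClasses_of_mem_range'
    {m n p : ℕ} {X Y : SchemeOver ℂ}
    (hX : IsSmoothProjective n X) (hY : IsSmoothProjective m Y) (g : Y ⟶ X)
    (hinj : Function.Injective (complexBetti.map g (2 * p)))
    {c : complexBetti Y (2 * p)} (hc : IsRationalClass c) (hpp : IsOfHodgeType m Y (2 * p) p p c)
    (hrange : c ∈ LinearMap.range (complexBetti.map g (2 * p)).hom)
    (hHC : ∀ c₀ : complexBetti X (2 * p), IsRationalClass c₀ →
    IsOfHodgeType n X (2 * p) p p c₀ → c₀ ∈ algebraicClasses X p) :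
    c ∈ algebraicClasses Y p :=
  mem_algebraicClasses_of_mem_range fulton1998_map_mem_algebraicClasses_holds' hX hY g hinj hc hpp hrange hHC

/-- (Hypothesis-free form of `mem_algebraicClasses_of_bijective`: the pull-back fact `fulton1998_map_mem_algebraicClasses` is
now the Literature theorem `fulton1998_map_mem_algebraicClasses_holds'`.) **Bijective pull-back**: HCᵖ(X) ⇒ HCᵖ(Y) when `g^* : H²ᵖ(X) → H²ᵖ(Y)` is bijective. [cite: VoisinHodgeI2002, §7.3.1–7.3.2] [cite: Voisin2013HodgeLociSurvey, §4.3 (pp. 18–19)] -/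
theorem mem_algebraicClasses_of_bijective'
    {m n p : ℕ} {X Y : SchemeOver ℂ}
    (hX : IsSmoothProjective n X) (hY : IsSmoothProjective m Y) (g : Y ⟶ X)
    (hbij : Function.Bijective (complexBetti.map g (2 * p)))
    (hHC : ∀ c₀ : complexBetti X (2 * p), IsRationalClass c₀ →
    IsOfHodgeType n X (2 * p) p p c₀ → c₀ ∈ algebraicClasses X p)
    (c : complexBetti Y (2 * p)) (hc : IsRationalClass c) (hpp : IsOfHodgeType m Y (2 * p) p p c) :
    c ∈ algebraicClasses Y p :=
  mem_algebraicClasses_of_bijective fulton1998_map_mem_algebraicClasses_holds' hX hY g hbij hHC c hc hpp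

/-- (Hypothesis-free form of `hodgeConjectureFor_of_lefschetzPackage_odd`: the pull-back fact `fulton1998_map_mem_algebraicClasses` is
now the Literature theorem `fulton1998_map_mem_algebraicClasses_holds'`.) **Odd core.** `g : Y ⟶ X` smooth projective, `dim Y = m` ODD, `g^*` bijective on `H²ᵖ` for
every `2p < m` (weak Lefschetz package); if the rational `(p,p)` classes of `X` are algebraic for
`2p < m`, the Hodge conjecture holds for `Y` (above the middle: hard Lefschetz on `Y`). [cite: Voisin2013HodgeLociSurvey, §4.3 (pp. 18–19)] [cite: VoisinHodgeI2002, Thm. 6.25, Rem. 6.27 and §7.1.2] -/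
theorem hodgeConjectureFor_of_lefschetzPackage_odd'
    {m n : ℕ} {X Y : SchemeOver ℂ} (hX : IsSmoothProjective n X) (hY : IsSmoothProjective m Y)
    (g : Y ⟶ X) (hm : Odd m)
    (hbij : ∀ p : ℕ, 2 * p < m → Function.Bijective (complexBetti.map g (2 * p)))
    (hHC : ∀ p : ℕ, 2 * p < m → ∀ c₀ : complexBetti X (2 * p), IsRationalClass c₀ →
    IsOfHodgeType n X (2 * p) p p c₀ → c₀ ∈ algebraicClasses X p) :
    HodgeConjectureFor m Y :=
  hodgeConjectureFor_of_lefschetzPackage_odd fulton1998_map_mem_algebraicClasses_holds' hX hY g hm hbij hHC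

/-- (Hypothesis-free form of `hodgeConjectureFor_of_lefschetzPackage_even`: the pull-back fact `fulton1998_map_mem_algebraicClasses` is
now the Literature theorem `fulton1998_map_mem_algebraicClasses_holds'`.) **Even core.** `g : Y ⟶ X` smooth projective, `dim Y = 2k`, `g^*` bijective on `H²ᵖ` for
`2p < 2k` and injective on `H²ᵏ`; (VG) every rational `(k,k)` class of `Y` lies in the range of
`g^*`; the rational `(p,p)` classes of `X` are algebraic for `p ≤ k`. Then the Hodge conjecture holds
for `Y`. [cite: Voisin2013HodgeLociSurvey, §4.3 Thm. 4.17 with conditions (a), (b) and Rem. 4.18 (p. 19)] [cite: VoisinHodgeI2002, Thm. 6.25, Rem. 6.27 and §7.1.2] -/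
theorem hodgeConjectureFor_of_lefschetzPackage_even'
    {k n : ℕ} {X Y : SchemeOver ℂ} (hX : IsSmoothProjective n X) (hY : IsSmoothProjective (2 * k) Y)
    (g : Y ⟶ X)
    (hbij : ∀ p : ℕ, 2 * p < 2 * k → Function.Bijective (complexBetti.map g (2 * p)))
    (hinj : Function.Injective (complexBetti.map g (2 * k)))
    (hVG : ∀ c : complexBetti Y (2 * k), IsRationalClass c → IsOfHodgeType (2 * k) Y (2 * k) k k c →
    c ∈ LinearMap.range (complexBetti.map g (2 * k)).hom)
    (hHC : ∀ p : ℕ, p ≤ k → ∀ c₀ : complexBetti X (2 * p), IsRationalClass c₀ →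
    IsOfHodgeType n X (2 * p) p p c₀ → c₀ ∈ algebraicClasses X p) :
    HodgeConjectureFor (2 * k) Y :=
  hodgeConjectureFor_of_lefschetzPackage_even fulton1998_map_mem_algebraicClasses_holds' hX hY g hbij hinj hVG hHC

/-- (Hypothesis-free form of `hodgeConjectureFor_hypersurfaceSection_of_odd`: the pull-back fact `fulton1998_map_mem_algebraicClasses` is
now the Literature theorem `fulton1998_map_mem_algebraicClasses_holds'`.) **ROW CL-LEF1.** `X` smooth projective of EVEN dimension `m + 1`, `e` any projective embedding,
`F` a form of degree `d ≥ 1` with smooth section `Y = X ∩ V₊(F)` of (odd) dimension `m`: if the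
rational `(p,p)` classes of `X` are algebraic for every `2p < m`, the Hodge conjecture holds for `Y`. [cite: VoisinHodgeII2003, §1.2.2 Thm. 1.23] [cite: Voisin2013HodgeLociSurvey, §4.3 (pp. 18–19)] [cite: VoisinHodgeI2002, Thm. 6.25, Rem. 6.27 and §7.1.2] -/
theorem hodgeConjectureFor_hypersurfaceSection_of_odd'
    {m : ℕ} {X : SchemeOver ℂ} (hX : IsSmoothProjective (m + 1) X) (e : ProjectiveEmbedding X)
    {d : ℕ} (hd : 1 ≤ d) (F : MvPolynomial (Fin (e.n + 1)) ℂ) (hF : F.IsHomogeneous d)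
    (hY : IsSmoothProjective m (e.hypersurfaceSection F hF)) (hm : Odd m)
    (hHC : ∀ p : ℕ, 2 * p < m → ∀ c₀ : complexBetti X (2 * p), IsRationalClass c₀ →
    IsOfHodgeType (m + 1) X (2 * p) p p c₀ → c₀ ∈ algebraicClasses X p) :
    HodgeConjectureFor m (e.hypersurfaceSection F hF) :=
  hodgeConjectureFor_hypersurfaceSection_of_odd fulton1998_map_mem_algebraicClasses_holds' hX e hd F hF hY hm hHC

/-- (Hypothesis-free form of `hodgeConjectureFor_hypersurfaceSection_of_odd_of_hodgeConjectureFor`: the pull-back fact `fulton1998_map_mem_algebraicClasses` is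
now the Literature theorem `fulton1998_map_mem_algebraicClasses_holds'`.) **CL-LEF1, closure form: HC(X) ⇒ HC(X ∩ V₊(F))** for every smooth odd-dimensional hypersurface
section of a smooth projective `X`, any degree, any embedding. [cite: VoisinHodgeII2003, §1.2.2 Thm. 1.23] [cite: Voisin2013HodgeLociSurvey, §4.3 (pp. 18–19)] -/
theorem hodgeConjectureFor_hypersurfaceSection_of_odd_of_hodgeConjectureFor'
    {m : ℕ} {X : SchemeOver ℂ} (hX : IsSmoothProjective (m + 1) X) (e : ProjectiveEmbedding X)
    {d : ℕ} (hd : 1 ≤ d) (F : MvPolynomial (Fin (e.n + 1)) ℂ) (hF : F.IsHomogeneous d)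
    (hY : IsSmoothProjective m (e.hypersurfaceSection F hF)) (hm : Odd m)
    (hHC : HodgeConjectureFor (m + 1) X) :
    HodgeConjectureFor m (e.hypersurfaceSection F hF) :=
  hodgeConjectureFor_hypersurfaceSection_of_odd_of_hodgeConjectureFor fulton1998_map_mem_algebraicClasses_holds' hX e hd F hF hY hm hHC

/-- (Hypothesis-free form of `hodgeConjectureFor_hypersurfaceSection_twoStep`: the pull-back fact `fulton1998_map_mem_algebraicClasses` is
now the Literature theorem `fulton1998_map_mem_algebraicClasses_holds'`.) **CL-LEF1 along a two-step smooth flag**: `X` smooth projective of dimension `m + 2`,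
`Y₁ = X ∩ V₊(F)` smooth of dimension `m + 1`, `Y = Y₁ ∩ V₊(G)` smooth of ODD dimension `m` (in any
embedding `e₁` of `Y₁`); HCᵖ(X) for `2p < m` ⇒ HC(Y). (Iterates along any smooth flag of
hypersurface sections ending in odd dimension: each descent below the middle is §B.) [cite: VoisinHodgeII2003, §1.2.2 Thm. 1.23] [cite: Voisin2013HodgeLociSurvey, §4.3 (pp. 18–19)] -/
theorem hodgeConjectureFor_hypersurfaceSection_twoStep'
    {m : ℕ} {X : SchemeOver ℂ} (hX : IsSmoothProjective (m + 2) X) (e : ProjectiveEmbedding X)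
    {d : ℕ} (hd : 1 ≤ d) (F : MvPolynomial (Fin (e.n + 1)) ℂ) (hF : F.IsHomogeneous d)
    (hY₁ : IsSmoothProjective (m + 1) (e.hypersurfaceSection F hF))
    (e₁ : ProjectiveEmbedding (e.hypersurfaceSection F hF)) {d₁ : ℕ} (hd₁ : 1 ≤ d₁)
    (G : MvPolynomial (Fin (e₁.n + 1)) ℂ) (hG : G.IsHomogeneous d₁)
    (hY : IsSmoothProjective m (e₁.hypersurfaceSection G hG)) (hm : Odd m)
    (hHC : ∀ p : ℕ, 2 * p < m → ∀ c₀ : complexBetti X (2 * p), IsRationalClass c₀ →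
    IsOfHodgeType (m + 2) X (2 * p) p p c₀ → c₀ ∈ algebraicClasses X p) :
    HodgeConjectureFor m (e₁.hypersurfaceSection G hG) :=
  hodgeConjectureFor_hypersurfaceSection_twoStep fulton1998_map_mem_algebraicClasses_holds' hX e hd F hF hY₁ e₁ hd₁ G hG hY hm hHC

/-- (Hypothesis-free form of `hodgeConjectureFor_hypersurfaceSection_of_middle_mem_range`: the pull-back fact `fulton1998_map_mem_algebraicClasses` is
now the Literature theorem `fulton1998_map_mem_algebraicClasses_holds'`.) **ROW CL-LEF2, consequence form.** `X` smooth projective of ODD dimension `2k + 1`,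
`Y = X ∩ V₊(F)` a smooth section of dimension `2k` (any degree, any embedding) such that
(VG) every rational `(k,k)` class of `Y` lies in the range of `H²ᵏ(X) → H²ᵏ(Y)`; if the rational
`(p,p)` classes of `X` are algebraic for `p ≤ k`, the Hodge conjecture holds for `Y` (restriction is
bijective below `2k` and injective on `H²ᵏ`, Voisin II Thm. 1.23). [cite: Voisin2013HodgeLociSurvey, §4.3 Thm. 4.17 with conditions (a), (b) and Rem. 4.18 (p. 19)] [cite: VoisinHodgeII2003, §1.2.2 Thm. 1.23] -/
theorem hodgeConjectureFor_hypersurfaceSection_of_middle_mem_range'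
    {k : ℕ} {X : SchemeOver ℂ} (hX : IsSmoothProjective (2 * k + 1) X) (e : ProjectiveEmbedding X)
    {d : ℕ} (hd : 1 ≤ d) (F : MvPolynomial (Fin (e.n + 1)) ℂ) (hF : F.IsHomogeneous d)
    (hY : IsSmoothProjective (2 * k) (e.hypersurfaceSection F hF))
    (hVG : ∀ c : complexBetti (e.hypersurfaceSection F hF) (2 * k), IsRationalClass c →
    IsOfHodgeType (2 * k) (e.hypersurfaceSection F hF) (2 * k) k k c →
    c ∈ LinearMap.range (complexBetti.map (e.hypersurfaceSectionι F hF) (2 * k)).hom)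
    (hHC : ∀ p : ℕ, p ≤ k → ∀ c₀ : complexBetti X (2 * p), IsRationalClass c₀ →
    IsOfHodgeType (2 * k + 1) X (2 * p) p p c₀ → c₀ ∈ algebraicClasses X p) :
    HodgeConjectureFor (2 * k) (e.hypersurfaceSection F hF) :=
  hodgeConjectureFor_hypersurfaceSection_of_middle_mem_range fulton1998_map_mem_algebraicClasses_holds' hX e hd F hF hY hVG hHC

/-- (Hypothesis-free form of `hodgeConjectureFor_hypersurfaceSection_of_middle_mem_range_of_hodgeConjectureFor`: the pull-back fact `fulton1998_map_mem_algebraicClasses` is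
now the Literature theorem `fulton1998_map_mem_algebraicClasses_holds'`.) **CL-LEF2, closure form: (VG) ∧ HC(X) ⇒ HC(X ∩ V₊(F))**. [cite: Voisin2013HodgeLociSurvey, §4.3 Thm. 4.17 with conditions (a), (b) and Rem. 4.18 (p. 19)] [cite: VoisinHodgeII2003, §1.2.2 Thm. 1.23] -/
theorem hodgeConjectureFor_hypersurfaceSection_of_middle_mem_range_of_hodgeConjectureFor'
    {k : ℕ} {X : SchemeOver ℂ} (hX : IsSmoothProjective (2 * k + 1) X) (e : ProjectiveEmbedding X)
    {d : ℕ} (hd : 1 ≤ d) (F : MvPolynomial (Fin (e.n + 1)) ℂ) (hF : F.IsHomogeneous d)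
    (hY : IsSmoothProjective (2 * k) (e.hypersurfaceSection F hF))
    (hVG : ∀ c : complexBetti (e.hypersurfaceSection F hF) (2 * k), IsRationalClass c →
    IsOfHodgeType (2 * k) (e.hypersurfaceSection F hF) (2 * k) k k c →
    c ∈ LinearMap.range (complexBetti.map (e.hypersurfaceSectionι F hF) (2 * k)).hom)
    (hHC : HodgeConjectureFor (2 * k + 1) X) :
    HodgeConjectureFor (2 * k) (e.hypersurfaceSection F hF) :=
  hodgeConjectureFor_hypersurfaceSection_of_middle_mem_range_of_hodgeConjectureFor fulton1998_map_mem_algebraicClasses_holds' hX e hd F hF hY hVG hHC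

/-! ### The very general hyperplane section (chapter LEF, row CL-LEF2, package discharged) -/

/-- (Hypothesis-free form of `veryGeneralSection_hodgeConjectureFor'`: the pull-back fact `fulton1998_map_mem_algebraicClasses` is
now the Literature theorem `fulton1998_map_mem_algebraicClasses_holds'`.) **ROW CL-LEF2 of ROUTE-P1O with the Lefschetz package discharged**: for `X ⊂ ℙᴺ_ℂ` smooth
projective of dimension `2k + 1` (closed immersion `ι`) satisfying the Hodge conjecture and (VG) for
the very general hyperplane section, for all `H` in a residual subset of `(ℙᴺ)^*(ℂ)`: if `X ∩ H` is
smooth of dimension `2k` then `X ∩ H` satisfies the Hodge conjecture (modulo the summit-side Fulton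
hypothesis `hFul`). [cite: Voisin2013HodgeLociSurvey, §4.3 Thm. 4.17 with conditions (a), (b) and Rem. 4.18 (p. 19)] [cite: VoisinHodgeII2003, §1.2.2 Thm. 1.23] -/
theorem veryGeneralSection_hodgeConjectureFor''
    {k N : ℕ} {X : SchemeOver ℂ} (hX : IsSmoothProjective (2 * k + 1) X)
    (ι : X ⟶ projectiveSpace N ℂ) [IsClosedImmersion ι.left]
    (hVG : VeryGeneralSectionHodgeClassesFromAmbient k N X ι) (hHC : HodgeConjectureFor (2 * k + 1) X) :
    ∀ᶠ H in residual (ComplexPoints (dualProjectiveSpace N ℂ)),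
    H ∈ universalSmoothLocus N ι (2 * k) →
    HodgeConjectureFor (2 * k) (fiberOver (UniversalHyperplaneSection.proj N ι) H) :=
  veryGeneralSection_hodgeConjectureFor' fulton1998_map_mem_algebraicClasses_holds' hX ι hVG hHC

end Literature.AlgebraicGeometry.HodgeTheory.HypersurfaceSectionHC

namespace Literature.AlgebraicGeometry.HodgeTheory.CoveringHC

/-! ### Finite coverings (chapter COV) -/

section

open AbelianVariety

/-- (Hypothesis-free form of `hodgeClasses_algebraic_iff_of_bijective`: the pull-back fact `fulton1998_map_mem_algebraicClasses` is
now the Literature theorem `fulton1998_map_mem_algebraicClasses_holds'`.) **HCᵖ(cover) ⟺ HCᵖ(base) wherever `g^*` is bijective**, for `g : Y ⟶ X` surjective between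
smooth projective varieties of the same dimension: (⇒) `g^* c₀` is rational of type `(p,p)`, hence
algebraic on `Y`, and algebraicity DESCENDS along `g` (van Geemen Lemma 3.7 / Voisin I Rem. 7.29,
tree `mem_algebraicClasses_of_surjective_of_hodgeClasses_algebraic` — no `hFul` needed);
(⇐) §A. [cite: vanGeemen1994HodgeAV, §3.6–3.7 Lemma 3.7] [cite: VoisinHodgeI2002, §7.3.2 Rem. 7.29] -/
theorem hodgeClasses_algebraic_iff_of_bijective'
    {n p : ℕ} {X Y : SchemeOver ℂ} (hX : IsSmoothProjective n X) (hY : IsSmoothProjective n Y)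
    (g : Y ⟶ X) [Surjective g.left] (hbij : Function.Bijective (complexBetti.map g (2 * p))) :
    (∀ c : complexBetti Y (2 * p), IsRationalClass c → IsOfHodgeType n Y (2 * p) p p c →
    c ∈ algebraicClasses Y p) ↔
    (∀ c₀ : complexBetti X (2 * p), IsRationalClass c₀ → IsOfHodgeType n X (2 * p) p p c₀ →
    c₀ ∈ algebraicClasses X p) :=
  hodgeClasses_algebraic_iff_of_bijective fulton1998_map_mem_algebraicClasses_holds' hX hY g hbij

/-- (Hypothesis-free form of `hodgeConjectureFor_of_coverWindow`: the pull-back fact `fulton1998_map_mem_algebraicClasses` is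
now the Literature theorem `fulton1998_map_mem_algebraicClasses_holds'`.) **WINDOW CORE.** `g : Y ⟶ X` smooth projective, `dim Y = m`, width `w`: if `g^*` is bijective
on `H²ᵖ` whenever `2p + w ≤ m` (a Barth–Lefschetz / Lazarsfeld package), the rational `(p,p)`
classes of `X` are algebraic in those degrees, and the rational `(p,p)` classes of `Y` in the
WINDOW `m - w < 2p ≤ m` are algebraic, then the Hodge conjecture holds for `Y`. Above the middle
(`m < 2p`) nothing is assumed: hard Lefschetz on `Y` reduces degree `2p` to degree `2(m - p)`. [cite: Lazarsfeld1980, Thm. 1] [cite: Lazarsfeld2004PositivityII, §7.1.C Thm. 7.1.15 and Thm. 7.1.16] [cite: VoisinHodgeI2002, Thm. 6.25, Rem. 6.27 and §7.1.2] -/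
theorem hodgeConjectureFor_of_coverWindow'
    {m n w : ℕ} {X Y : SchemeOver ℂ} (hX : IsSmoothProjective n X) (hY : IsSmoothProjective m Y)
    (g : Y ⟶ X)
    (hbij : ∀ p : ℕ, 2 * p + w ≤ m → Function.Bijective (complexBetti.map g (2 * p)))
    (hHC : ∀ p : ℕ, 2 * p + w ≤ m → ∀ c₀ : complexBetti X (2 * p), IsRationalClass c₀ →
    IsOfHodgeType n X (2 * p) p p c₀ → c₀ ∈ algebraicClasses X p)
    (hwin : ∀ p : ℕ, m < 2 * p + w → 2 * p ≤ m → ∀ c : complexBetti Y (2 * p), IsRationalClass c →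
    IsOfHodgeType m Y (2 * p) p p c → c ∈ algebraicClasses Y p) :
    HodgeConjectureFor m Y :=
  hodgeConjectureFor_of_coverWindow fulton1998_map_mem_algebraicClasses_holds' hX hY g hbij hHC hwin

/-- (Hypothesis-free form of `hodgeConjectureFor_cover_even_middle`: the pull-back fact `fulton1998_map_mem_algebraicClasses` is
now the Literature theorem `fulton1998_map_mem_algebraicClasses_holds'`.) **Even core, middle isolated** (`m = 2k`, `w ≤ 2`): `g^*` bijective on `H²ᵖ` for `p < k`,
HCᵖ(X) there, and the rational `(k,k)` classes of `Y` algebraic ⇒ HC(Y). Shape of every cyclic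
cover of an even-dimensional base branched along an ample-power divisor, of every double AND every
triple cover of `ℙ^{2k}` (Thm. 7.1.15: `i ≤ 2k + 1 - d ≥ 2k - 2`). [cite: Lazarsfeld1980, Thm. 1] [cite: Lazarsfeld2004PositivityII, §7.1.C Thm. 7.1.15 and Thm. 7.1.16] [cite: VoisinHodgeI2002, Thm. 6.25, Rem. 6.27 and §7.1.2] -/
theorem hodgeConjectureFor_cover_even_middle'
    {k n : ℕ} {X Y : SchemeOver ℂ} (hX : IsSmoothProjective n X) (hY : IsSmoothProjective (2 * k) Y)
    (g : Y ⟶ X)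
    (hbij : ∀ p : ℕ, p < k → Function.Bijective (complexBetti.map g (2 * p)))
    (hHC : ∀ p : ℕ, p < k → ∀ c₀ : complexBetti X (2 * p), IsRationalClass c₀ →
    IsOfHodgeType n X (2 * p) p p c₀ → c₀ ∈ algebraicClasses X p)
    (hmid : ∀ c : complexBetti Y (2 * k), IsRationalClass c → IsOfHodgeType (2 * k) Y (2 * k) k k c →
    c ∈ algebraicClasses Y k) :
    HodgeConjectureFor (2 * k) Y :=
  hodgeConjectureFor_cover_even_middle fulton1998_map_mem_algebraicClasses_holds' hX hY g hbij hHC hmid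

/-- (Hypothesis-free form of `hodgeConjectureFor_cover_even_of_range`: the pull-back fact `fulton1998_map_mem_algebraicClasses` is
now the Literature theorem `fulton1998_map_mem_algebraicClasses_holds'`.) **Even core with the range hypothesis** (the P1O even core transplanted): for covers `g^*` is
injective on `H²ᵏ` automatically (§B), so the middle hypothesis may be put as "(R) every rational
`(k,k)` class of `Y` is a pull-back" + HCᵏ(X). [cite: Lazarsfeld1980, Thm. 1] [cite: Lazarsfeld2004PositivityII, §7.1.C Thm. 7.1.15 and Thm. 7.1.16] [cite: vanGeemen1994HodgeAV, §3.6–3.7 Lemma 3.7] [cite: VoisinHodgeI2002, §7.3.2 Lemma 7.28 and Rem. 7.29] -/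
theorem hodgeConjectureFor_cover_even_of_range'
    {k : ℕ} {X Y : SchemeOver ℂ} (hX : IsSmoothProjective (2 * k) X)
    (hY : IsSmoothProjective (2 * k) Y) (g : Y ⟶ X) [Surjective g.left]
    (hbij : ∀ p : ℕ, p < k → Function.Bijective (complexBetti.map g (2 * p)))
    (hR : ∀ c : complexBetti Y (2 * k), IsRationalClass c → IsOfHodgeType (2 * k) Y (2 * k) k k c →
    c ∈ LinearMap.range (complexBetti.map g (2 * k)).hom)
    (hHC : ∀ p : ℕ, p ≤ k → ∀ c₀ : complexBetti X (2 * p), IsRationalClass c₀ →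
    IsOfHodgeType (2 * k) X (2 * p) p p c₀ → c₀ ∈ algebraicClasses X p) :
    HodgeConjectureFor (2 * k) Y :=
  hodgeConjectureFor_cover_even_of_range fulton1998_map_mem_algebraicClasses_holds' hX hY g hbij hR hHC

/-- (Hypothesis-free form of `hodgeConjectureFor_cover_projectiveSpace_odd`: the pull-back fact `fulton1998_map_mem_algebraicClasses` is
now the Literature theorem `fulton1998_map_mem_algebraicClasses_holds'`.) **ROW COV-A (base `ℙ^{2k+1}`).** `Y` smooth projective of ODD dimension `m`, `g : Y ⟶ ℙᵐ` with
`g^*` bijective on `H²ᵖ` for `2p < m` — PRINT: every double cover of `ℙᵐ` (Lazarsfeld, `d = 2`),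
every cyclic cover of `ℙᵐ` of any degree branched along a smooth hypersurface (Thm. 7.1.16 with
`E = 𝒪(a)`, `e = 1`) — satisfies the Hodge conjecture, unconditionally. [cite: Lazarsfeld1980, Thm. 1] [cite: Lazarsfeld2004PositivityII, §7.1.C Thm. 7.1.15 and Thm. 7.1.16] -/
theorem hodgeConjectureFor_cover_projectiveSpace_odd'
    {m : ℕ} {Y : SchemeOver ℂ} (hY : IsSmoothProjective m Y) (g : Y ⟶ projectiveSpace m ℂ)
    (hm : Odd m) (hbij : ∀ p : ℕ, 2 * p < m → Function.Bijective (complexBetti.map g (2 * p))) :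
    HodgeConjectureFor m Y :=
  hodgeConjectureFor_cover_projectiveSpace_odd fulton1998_map_mem_algebraicClasses_holds' hY g hm hbij

/-- (Hypothesis-free form of `hodgeConjectureFor_fivefold_cover`: the pull-back fact `fulton1998_map_mem_algebraicClasses` is
now the Literature theorem `fulton1998_map_mem_algebraicClasses_holds'`.) **ROW COV-A′ (fivefolds, any base).** `g : Y ⟶ X`, `dim Y = 5`, `g^*` bijective on `H⁴` ONLY,
and the rational `(2,2)` classes of `X` algebraic ⇒ HC(Y): degrees `0, 2` are free
(`hodgeClasses_algebraic_of_le_one`), degree `4` is §A, degrees `6, 8, 10` by hard Lefschetz. First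
dimension in which the chapter has content (in dimension `4` a `w = 1` cover only re-isolates the
middle `H⁴`, which is where HC is open for every fourfold anyway). Bases with HC²: `ℙ⁵`, quadrics /
Grassmannians / flag fivefolds, smooth hypersurfaces `X⁵ ⊂ ℙ⁶` (tree), uniruled / `CH₀`-degenerate
fivefolds of the index, fivefold double covers themselves (iterate). [cite: Lazarsfeld1980, Thm. 1] [cite: Lazarsfeld2004PositivityII, §7.1.C Thm. 7.1.15 and Thm. 7.1.16] [cite: VoisinHodgeI2002, Thm. 11.30] [cite: VoisinHodgeI2002, Thm. 6.25, Rem. 6.27 and §7.1.2] -/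
theorem hodgeConjectureFor_fivefold_cover'
    {n : ℕ} {X Y : SchemeOver ℂ} (hX : IsSmoothProjective n X) (hY : IsSmoothProjective 5 Y)
    (g : Y ⟶ X) (hbij : Function.Bijective (complexBetti.map g (2 * 2)))
    (hHC2 : ∀ c₀ : complexBetti X (2 * 2), IsRationalClass c₀ → IsOfHodgeType n X (2 * 2) 2 2 c₀ →
    c₀ ∈ algebraicClasses X 2) :
    HodgeConjectureFor 5 Y :=
  hodgeConjectureFor_fivefold_cover fulton1998_map_mem_algebraicClasses_holds' hX hY g hbij hHC2

/-- (Hypothesis-free form of `hodgeConjectureFor_fivefold_cover_projectiveSpace`: the pull-back fact `fulton1998_map_mem_algebraicClasses` is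
now the Literature theorem `fulton1998_map_mem_algebraicClasses_holds'`.) **COV-A′ over `ℙ⁵`**: a smooth projective fivefold `Y` with `g : Y ⟶ ℙ⁵`, `g^*` bijective on
`H⁴` (PRINT: double, triple — `i ≤ 5 + 1 - 3 = 3`? no: triple covers give `i ≤ 3` only, so this row
is double covers and all cyclic covers branched along a smooth hypersurface) satisfies HC. [cite: Lazarsfeld1980, Thm. 1] [cite: Lazarsfeld2004PositivityII, §7.1.C Thm. 7.1.15 and Thm. 7.1.16] [cite: VoisinHodgeI2002, Thm. 11.30] -/
theorem hodgeConjectureFor_fivefold_cover_projectiveSpace'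
    {Y : SchemeOver ℂ} (hY : IsSmoothProjective 5 Y)
    (g : Y ⟶ projectiveSpace 5 ℂ) (hbij : Function.Bijective (complexBetti.map g (2 * 2))) :
    HodgeConjectureFor 5 Y :=
  hodgeConjectureFor_fivefold_cover_projectiveSpace fulton1998_map_mem_algebraicClasses_holds' hY g hbij

/-- (Hypothesis-free form of `hodgeConjectureFor_cover_oddHypersurface`: the pull-back fact `fulton1998_map_mem_algebraicClasses` is
now the Literature theorem `fulton1998_map_mem_algebraicClasses_holds'`.) **ROW COV-A″ (odd hypersurface base).** `X ⊂ ℙ^{m+1}` a smooth hypersurface of ODD dimension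
`m` (HC(X): tree `hodgeConjectureFor_of_isHypersurfaceCutOutBy_of_odd`), `g : Y ⟶ X` with `g^*`
bijective below the middle (PRINT for cyclic covers branched along `X ∩ V(G)` smooth, Thm. 7.1.16
`e = 1`) ⇒ HC(Y). Infinitely many general-type families off every sector of the index. [cite: Lazarsfeld1980, Thm. 1] [cite: Lazarsfeld2004PositivityII, §7.1.C Thm. 7.1.15 and Thm. 7.1.16] [cite: VoisinHodgeII2003, §1.2.2 Thm. 1.23] -/
theorem hodgeConjectureFor_cover_oddHypersurface'
    {m d : ℕ} {X Y : SchemeOver ℂ} {F : MvPolynomial (Fin (m + 2)) ℂ}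
    (hX : IsSmoothProjective m X) (hm : Odd m) (hF : F.IsHomogeneous d)
    (hcut : IsHypersurfaceCutOutBy (m + 1) F X) (hY : IsSmoothProjective m Y) (g : Y ⟶ X)
    (hbij : ∀ p : ℕ, 2 * p < m → Function.Bijective (complexBetti.map g (2 * p))) :
    HodgeConjectureFor m Y :=
  hodgeConjectureFor_cover_oddHypersurface fulton1998_map_mem_algebraicClasses_holds' hX hm hF hcut hY g hbij

/-- (Hypothesis-free form of `hodgeConjectureFor_cover_of_hodgeConjectureFor`: the pull-back fact `fulton1998_map_mem_algebraicClasses` is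
now the Literature theorem `fulton1998_map_mem_algebraicClasses_holds'`.) **ROW COV-A‴ (iterated covers / any HC base of odd dimension).** HC(X) with `dim X = m` odd and
`g^*` bijective below the middle ⇒ HC(Y); in particular towers of `w = 1` covers
`Y_r → … → Y_1 → ℙ^{2k+1}` and covers of odd-dimensional abelian varieties with HC (CONDITIONAL row
COV-AV: Debarre 2006 Thm. 1 gives the package for covers of SIMPLE abelian varieties not factoring
through an isogeny; HC of the base is the abelian summit sector). [cite: Lazarsfeld1980, Thm. 1] [cite: Lazarsfeld2004PositivityII, §7.1.C Thm. 7.1.15 and Thm. 7.1.16] -/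
theorem hodgeConjectureFor_cover_of_hodgeConjectureFor'
    {m : ℕ} {X Y : SchemeOver ℂ} (hX : IsSmoothProjective m X) (hY : IsSmoothProjective m Y)
    (g : Y ⟶ X) (hm : Odd m)
    (hbij : ∀ p : ℕ, 2 * p < m → Function.Bijective (complexBetti.map g (2 * p)))
    (hHC : HodgeConjectureFor m X) : HodgeConjectureFor m Y :=
  hodgeConjectureFor_cover_of_hodgeConjectureFor fulton1998_map_mem_algebraicClasses_holds' hX hY g hm hbij hHC

/-- (Hypothesis-free form of `hodgeConjectureFor_cover_projectiveSpace_odd_width_two`: the pull-back fact `fulton1998_map_mem_algebraicClasses` is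
now the Literature theorem `fulton1998_map_mem_algebraicClasses_holds'`.) **ROW COV-C (width two, base `ℙ^{2k+1}`).** `g : Y ⟶ ℙ^{2k+1}` with `g^*` bijective on `H²ᵖ`
for `2p ≤ 2k - 1` (PRINT: triple covers, Lazarsfeld `d = 3`; covers inside `Tot(E)`, `E` ample of
rank `2`, Thm. 7.1.16): HC(Y) ⟸ the rational `(k,k)` classes of `Y` (degree `2k = dim Y - 1`) are
algebraic — the single open degree. [cite: Lazarsfeld1980, Thm. 1] [cite: Lazarsfeld2004PositivityII, §7.1.C Thm. 7.1.15 and Thm. 7.1.16] -/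
theorem hodgeConjectureFor_cover_projectiveSpace_odd_width_two'
    {k : ℕ} {Y : SchemeOver ℂ}
    (hY : IsSmoothProjective (2 * k + 1) Y) (g : Y ⟶ projectiveSpace (2 * k + 1) ℂ)
    (hbij : ∀ p : ℕ, 2 * p + 2 ≤ 2 * k + 1 → Function.Bijective (complexBetti.map g (2 * p)))
    (hsub : ∀ c : complexBetti Y (2 * k), IsRationalClass c →
    IsOfHodgeType (2 * k + 1) Y (2 * k) k k c → c ∈ algebraicClasses Y k) :
    HodgeConjectureFor (2 * k + 1) Y :=
  hodgeConjectureFor_cover_projectiveSpace_odd_width_two fulton1998_map_mem_algebraicClasses_holds' hY g hbij hsub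

/-- (Hypothesis-free form of `hodgeConjectureFor_doubleCover_projectiveSpace_odd`: the pull-back fact `fulton1998_map_mem_algebraicClasses` is
now the Literature theorem `fulton1998_map_mem_algebraicClasses_holds'`.) **Rung granted Lazarsfeld's theorem `hLaz` (and Fulton Cor. 19.2 (b) `hFul`): every smooth DOUBLE cover of an odd-dimensional
projective space satisfies the Hodge conjecture** — e.g. double covers of `ℙ⁵` branched along a
smooth hypersurface of degree `2a`, of general type for `a ≥ 7`. [cite: Lazarsfeld1980, Thm. 1] [cite: Lazarsfeld2004PositivityII, §7.1.C Thm. 7.1.15 and Thm. 7.1.16] -/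
theorem hodgeConjectureFor_doubleCover_projectiveSpace_odd'
    (hLaz : Lazarsfeld1980_barthLefschetzForCoverings) {n : ℕ} {Y : SchemeOver ℂ}
    (hY : IsSmoothProjective n Y) (hirr : IrreducibleSpace ↥Y.left) (g : Y ⟶ projectiveSpace n ℂ)
    (hg : IsFiniteCoverOfDegree 2 g) (hn : Odd n) : HodgeConjectureFor n Y :=
  hodgeConjectureFor_doubleCover_projectiveSpace_odd fulton1998_map_mem_algebraicClasses_holds' hLaz hY hirr g hg hn

/-- (Hypothesis-free form of `hodgeConjectureFor_tripleCover_projectiveSpace_odd`: the pull-back fact `fulton1998_map_mem_algebraicClasses` is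
now the Literature theorem `fulton1998_map_mem_algebraicClasses_holds'`.) **Rung granted Lazarsfeld's theorem `hLaz` (and Fulton Cor. 19.2 (b) `hFul`): smooth TRIPLE covers `Y → ℙ^{2k+1}`** satisfy HC
as soon as their rational `(k,k)` classes in `H^{2k}` are algebraic (the one open degree). [cite: Lazarsfeld1980, Thm. 1] [cite: Lazarsfeld2004PositivityII, §7.1.C Thm. 7.1.15 and Thm. 7.1.16] -/
theorem hodgeConjectureFor_tripleCover_projectiveSpace_odd'
    (hLaz : Lazarsfeld1980_barthLefschetzForCoverings) {k : ℕ} {Y : SchemeOver ℂ}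
    (hY : IsSmoothProjective (2 * k + 1) Y) (hirr : IrreducibleSpace ↥Y.left)
    (g : Y ⟶ projectiveSpace (2 * k + 1) ℂ) (hg : IsFiniteCoverOfDegree 3 g)
    (hsub : ∀ c : complexBetti Y (2 * k), IsRationalClass c →
    IsOfHodgeType (2 * k + 1) Y (2 * k) k k c → c ∈ algebraicClasses Y k) :
    HodgeConjectureFor (2 * k + 1) Y :=
  hodgeConjectureFor_tripleCover_projectiveSpace_odd fulton1998_map_mem_algebraicClasses_holds' hLaz hY hirr g hg hsub

/-- (Hypothesis-free form of `hodgeConjectureFor_doubleCover_projectiveSpace_even`: the pull-back fact `fulton1998_map_mem_algebraicClasses` is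
now the Literature theorem `fulton1998_map_mem_algebraicClasses_holds'`.) **Rung granted Lazarsfeld's theorem `hLaz` (and Fulton Cor. 19.2 (b) `hFul`): double covers of `ℙ^{2k}`** — HC ⟺ the middle. [cite: Lazarsfeld1980, Thm. 1] [cite: Lazarsfeld2004PositivityII, §7.1.C Thm. 7.1.15 and Thm. 7.1.16] [cite: VoisinHodgeI2002, Thm. 6.25, Rem. 6.27 and §7.1.2] -/
theorem hodgeConjectureFor_doubleCover_projectiveSpace_even'
    (hLaz : Lazarsfeld1980_barthLefschetzForCoverings) {k : ℕ} {Y : SchemeOver ℂ}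
    (hY : IsSmoothProjective (2 * k) Y) (hirr : IrreducibleSpace ↥Y.left)
    (g : Y ⟶ projectiveSpace (2 * k) ℂ) (hg : IsFiniteCoverOfDegree 2 g)
    (hmid : ∀ c : complexBetti Y (2 * k), IsRationalClass c → IsOfHodgeType (2 * k) Y (2 * k) k k c →
    c ∈ algebraicClasses Y k) :
    HodgeConjectureFor (2 * k) Y :=
  hodgeConjectureFor_doubleCover_projectiveSpace_even fulton1998_map_mem_algebraicClasses_holds' hLaz hY hirr g hg hmid

/-- (Hypothesis-free form of `hodgeConjectureFor_cover_simpleAbelian_window`: the pull-back fact `fulton1998_map_mem_algebraicClasses` is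
now the Literature theorem `fulton1998_map_mem_algebraicClasses_holds'`.) **Rung granted Debarre's theorem (`hDeb`) and Fulton Cor. 19.2 (b) (`hFul`): covers of degree
`d` of a SIMPLE abelian variety `A` not factoring through an isogeny**, window form: `f^*` is
bijective on `H²ᵖ` for `2p + (d - 1) ≤ dim A`, so HC(Y) follows from HCᵖ(A) in that range together
with the algebraicity of the rational `(p,p)` classes of `Y` in the window
`dim A - (d - 1) < 2p ≤ dim A`. [cite: Debarre2006, Thm. 1 and the following paragraph (p. 3)]
[cite: Lazarsfeld2004PositivityII, §7.1.C Thm. 7.1.16] [cite: VoisinHodgeI2002, Thm. 6.25, Rem. 6.27 and §7.1.2] -/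
theorem hodgeConjectureFor_cover_simpleAbelian_window'
    (hDeb : Debarre2006_coverSimpleAbelian_barthLefschetz) {d : ℕ} (A : AbelianVariety ℂ)
    (hA : A.IsSimple) {Y : SchemeOver ℂ} (hY : IsSmoothProjective A.dim Y)
    (hirr : IrreducibleSpace ↥Y.left) (f : Y ⟶ A.X) (hf : IsFiniteCoverOfDegree d f)
    (hnf : DoesNotFactorThroughIsogeny A f)
    (hHC : ∀ p : ℕ, 2 * p + (d - 1) ≤ A.dim → ∀ c₀ : complexBetti A.X (2 * p), IsRationalClass c₀ →
    IsOfHodgeType A.dim A.X (2 * p) p p c₀ → c₀ ∈ algebraicClasses A.X p)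
    (hwin : ∀ p : ℕ, A.dim < 2 * p + (d - 1) → 2 * p ≤ A.dim → ∀ c : complexBetti Y (2 * p),
    IsRationalClass c → IsOfHodgeType A.dim Y (2 * p) p p c → c ∈ algebraicClasses Y p) :
    HodgeConjectureFor A.dim Y :=
  hodgeConjectureFor_cover_simpleAbelian_window fulton1998_map_mem_algebraicClasses_holds' hDeb A hA hY hirr f hf hnf hHC hwin

/-- (Hypothesis-free form of `hodgeConjectureFor_doubleCover_simpleAbelian_odd`: the pull-back fact `fulton1998_map_mem_algebraicClasses` is
now the Literature theorem `fulton1998_map_mem_algebraicClasses_holds'`.) **Rung granted Debarre's theorem: DOUBLE covers `Y → A` of a simple abelian variety of ODD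
dimension `n`, not factoring through an isogeny, satisfy the Hodge conjecture as soon as the
rational `(p,p)` classes of `A` are algebraic for `2p < n`** (`f^*` bijective on `Hⁱ`, `i ≤ n - 1`:
no window; above the middle by hard Lefschetz on `Y`). E.g. `A` simple of odd PRIME dimension, where
HC(A) is known (Tankeev–Ribet), gives HC for every such double cover — a non-abelian variety.
[cite: Debarre2006, Thm. 1 and the following paragraph (p. 3)] [cite: Lazarsfeld2004PositivityII, §7.1.C Thm. 7.1.16] -/
theorem hodgeConjectureFor_doubleCover_simpleAbelian_odd'
    (hDeb : Debarre2006_coverSimpleAbelian_barthLefschetz) (A : AbelianVariety ℂ) (hA : A.IsSimple)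
    (hn : Odd A.dim) {Y : SchemeOver ℂ} (hY : IsSmoothProjective A.dim Y)
    (hirr : IrreducibleSpace ↥Y.left) (f : Y ⟶ A.X) (hf : IsFiniteCoverOfDegree 2 f)
    (hnf : DoesNotFactorThroughIsogeny A f)
    (hHC : ∀ p : ℕ, 2 * p < A.dim → ∀ c₀ : complexBetti A.X (2 * p), IsRationalClass c₀ →
    IsOfHodgeType A.dim A.X (2 * p) p p c₀ → c₀ ∈ algebraicClasses A.X p) :
    HodgeConjectureFor A.dim Y :=
  hodgeConjectureFor_doubleCover_simpleAbelian_odd fulton1998_map_mem_algebraicClasses_holds' hDeb A hA hn hY hirr f hf hnf hHC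

/-- (Hypothesis-free form of `hodgeConjectureFor_doubleCover_simpleAbelian_odd_of_hodgeConjectureFor`: the pull-back fact `fulton1998_map_mem_algebraicClasses` is
now the Literature theorem `fulton1998_map_mem_algebraicClasses_holds'`.) The same with HC(A) as the hypothesis: **HC(A) ⇒ HC(Y)** for double covers of a simple abelian
variety of odd dimension not factoring through an isogeny (granted `hDeb`, `hFul`).
[cite: Debarre2006, Thm. 1 and the following paragraph (p. 3)] -/
theorem hodgeConjectureFor_doubleCover_simpleAbelian_odd_of_hodgeConjectureFor'
    (hDeb : Debarre2006_coverSimpleAbelian_barthLefschetz) (A : AbelianVariety ℂ) (hA : A.IsSimple)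
    (hn : Odd A.dim) {Y : SchemeOver ℂ} (hY : IsSmoothProjective A.dim Y)
    (hirr : IrreducibleSpace ↥Y.left) (f : Y ⟶ A.X) (hf : IsFiniteCoverOfDegree 2 f)
    (hnf : DoesNotFactorThroughIsogeny A f) (hHC : HodgeConjectureFor A.dim A.X) :
    HodgeConjectureFor A.dim Y :=
  hodgeConjectureFor_doubleCover_simpleAbelian_odd_of_hodgeConjectureFor fulton1998_map_mem_algebraicClasses_holds' hDeb A hA hn hY hirr f hf hnf hHC

end

end Literature.AlgebraicGeometry.HodgeTheory.CoveringHC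

end
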